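import Summits.ResolutionOfSingularities.ResolutionOfSingularities.Theorems.HilbertSamuelEliminationSigmaMaxModificationsCorridor3WLadderIsoKernelCPSliceFiniteType
import HarnessLib

/-!
# [OURS · L1 W4.2] THE ISO-KERNEL SLICE IN COSSART–PILTANT'S FRAME — INTRINSIC FORM: canonical stalk embeddings along an integral
# isolated point tower, and the slice stated on `IsIsoPointTower` + the origin germ alone (modulo the printed CP 2019 Thm. 1.5)

Crux chain w42 (`SigmaMaxModifications`, stmt-ResolutionOfSingularities-18506; conjunct `SigmaMaxModificationsCorridor3`, stmt-…-19249),
line `w_ladder`, registered stubs `stub_isoInsepTower` / `stub_isoSepRecurrent`. Lead res-L1-w42-lead-1 (gen 5). Helper file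
`--supports stmt-ResolutionOfSingularities-19249`; kernel only (no definition, no new named fact; CONDITIONAL on `CossartPiltant2019LocalPermissible`).

WHAT IS PROVED. (§1, `exists_stalk_embeddings`) Along a tower of blow-ups with integral stages and marked points `pt (n+1) ↦ pt n`, every
injective embedding `θ₀ : 𝒪_{X_0,pt 0} ↪ L` into a field extends to a COMPATIBLE FAMILY of injective stalk embeddings `θ n : 𝒪_{X_n,pt n} ↪ L`
(`θ (n+1) := F_n ∘ ε_{pt (n+1)}` with `ε` the canonical embedding `IsBlowup.stalkEmb` into `K(X_n)` and `F_n : K(X_n) → L` the extension of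
`θ n`; `θ (n+1) ∘ π_n^♯ = θ n`). (§2, `false_of_isIsoPointTower_pCyclic_of_CP`) Hence the CP-frame slice of p555556 with the embeddings
DISCHARGED: Cossart–Piltant's frame + an isolated E3 point tower `IsIsoPointTower N ν T pt` (integral stages, bottom stage of finite type over a
field, `ν ≠ Φ^{(N)}`, `dim 𝒪_{X_0,x_0} ≤ N`) + ONE injective embedding `θ₀` of the origin stalk into `L` identifying it with CP's germ
(`R ⊆ θ₀(𝒪)` dominated; `θ₀(𝒪) = (R[x])_{𝔪_O ∩ R[x]}` for every valuation ring `O` dominating it) ⇒ `False` (mod print).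

HONEST FRAMING. OURS bookkeeping; nothing here is a statement of H. Hironaka's manuscript [Hironaka2017] nor a new claim about
[CossartPiltant2019] / [CossartJannsenSaito2020]. AI-written; AI review is weaker than expert review.

References: V. Cossart, O. Piltant, J. Algebra 529 (2019), Thm. 1.5 [CossartPiltant2019]; J. Kollár (2007) §1.4 (`ε_{x'}`) [Kollar2007];
The Stacks Project, Tag 0804 [StacksProject].
-/

noncomputable section

set_option linter.dupNamespace false

open Polynomial IsLocalRing AlgebraicGeometry CategoryTheory
open Literature.AlgebraicGeometry.Resolution Literature.AlgebraicGeometry.CossartJannsenSaito2020 Literature.RingTheory.HilbertSamuel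
open Summit.ResolutionOfSingularities.ResolutionOfSingularities.Cruxes.SigmaMaxModifications.IdeasL1Idea2R4 (IsIsoPointTower)

namespace Summit.ResolutionOfSingularities.ResolutionOfSingularities.Cruxes.SigmaMaxModifications.IdeasL1C5

universe u

variable {L : Type u} [Field L]

/-! ## §1. Canonical compatible stalk embeddings along an integral tower -/

section Embeddings

variable {T : BlowupTower.{u}} {pt : ∀ n, T.X n}

/-- **ONE STEP**: an injective `θ : 𝒪_{X_n, pt n} ↪ L` extends to an injective `θ' : 𝒪_{X_{n+1}, pt (n+1)} ↪ L` with `θ' ∘ π_n^♯ = θ` (transported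
along `π_n (pt (n+1)) = pt n`): `θ' = F ∘ ε_{pt (n+1)}`, `F` the extension of `θ` to the function field `K(X_n)` (a fraction field of every stalk
of the integral `X_n`), `ε` the canonical embedding of the blown-up stalk (`IsBlowup.stalkEmb`). [cite: Kollar2007, §1.4] -/
theorem exists_stalk_embedding_succ {n : ℕ} (hint : IsIntegral (T.X n)) (hpt : (T.π n).base (pt (n + 1)) = pt n)
    (θ : (T.X n).presheaf.stalk (pt n) →+* L) (hθ : Function.Injective θ) :
    ∃ θ' : (T.X (n + 1)).presheaf.stalk (pt (n + 1)) →+* L, Function.Injective θ' ∧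
      θ'.comp ((T.π n).stalkMap (pt (n + 1))).hom = θ.comp ((T.X n).presheaf.stalkCongr (.of_eq hpt)).hom.hom := by
  haveI := T.ln n
  haveI := T.ln (n + 1)
  haveI := hint
  set ψ : (T.X n).presheaf.stalk ((T.π n).base (pt (n + 1))) →+* L := θ.comp ((T.X n).presheaf.stalkCongr (.of_eq hpt)).hom.hom with hψ
  have hψinj : Function.Injective ψ := hθ.comp ((T.X n).presheaf.stalkCongr (.of_eq hpt)).commRingCatIsoToRingEquiv.injective
  let F : (T.X n).functionField →+* L := IsFractionRing.lift hψinj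
  refine ⟨F.comp ((T.isBlowup n).stalkEmb (pt (n + 1))), F.injective.comp ((T.isBlowup n).stalkEmb_injective (pt (n + 1))), ?_⟩
  rw [RingHom.comp_assoc, (T.isBlowup n).stalkEmb_comp_stalkMap]
  exact RingHom.ext fun a => IsFractionRing.lift_algebraMap hψinj a

/-- **CANONICAL COMPATIBLE STALK EMBEDDINGS ALONG AN INTEGRAL TOWER**: every injective `θ₀ : 𝒪_{X_0,pt 0} ↪ L` extends to a family
`θ n : 𝒪_{X_n, pt n} ↪ L` of injective embeddings with `θ (n+1) ∘ π_n^♯ = θ n` (the hypotheses `θ`/`hinj`/`hcomp` of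
`false_of_isIsoPointTower_of_stalk_embeddings_of_CP(_finiteType)`). [cite: Kollar2007, §1.4] -/
theorem exists_stalk_embeddings (hint : ∀ n, IsIntegral (T.X n)) (hpt : ∀ n, (T.π n).base (pt (n + 1)) = pt n)
    (θ₀ : (T.X 0).presheaf.stalk (pt 0) →+* L) (h₀ : Function.Injective θ₀) :
    ∃ θ : ∀ n, (T.X n).presheaf.stalk (pt n) →+* L, θ 0 = θ₀ ∧ (∀ n, Function.Injective (θ n)) ∧
      ∀ n, (θ (n + 1)).comp ((T.π n).stalkMap (pt (n + 1))).hom = (θ n).comp ((T.X n).presheaf.stalkCongr (.of_eq (hpt n))).hom.hom := by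
  -- the sequence of embeddings with their injectivity, by recursion
  let seq : ∀ n, {θ : (T.X n).presheaf.stalk (pt n) →+* L // Function.Injective θ} := fun n =>
    Nat.rec (motive := fun n => {θ : (T.X n).presheaf.stalk (pt n) →+* L // Function.Injective θ}) ⟨θ₀, h₀⟩
      (fun n s => ⟨(exists_stalk_embedding_succ (hint n) (hpt n) s.1 s.2).choose,
        (exists_stalk_embedding_succ (hint n) (hpt n) s.1 s.2).choose_spec.1⟩) n
  refine ⟨fun n => (seq n).1, rfl, fun n => (seq n).2, fun n => ?_⟩
  exact (exists_stalk_embedding_succ (hint n) (hpt n) (seq n).1 (seq n).2).choose_spec.2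

end Embeddings

/-! ## §2. The slice, intrinsic form -/

section SliceIntrinsic

/-- **THE ISO-KERNEL SLICE IN COSSART–PILTANT'S FRAME — INTRINSIC FORM (modulo print).** Cossart–Piltant's frame (verbatim); an isolated E3
point tower `IsIsoPointTower N ν T pt` with integral stages over a bottom stage of finite type over a field, `ν ≠ Φ^{(N)}`, `dim 𝒪_{X_0,x_0} ≤ N`;
ONE injective embedding `θ₀` of the origin stalk into `L` whose image is CP's germ at the centre of every dominating valuation ring and contains
`R` dominated. Then `False` — CONDITIONAL on `CossartPiltant2019LocalPermissible` (a printed theorem).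
[cite: CossartPiltant2019, Thm. 1.5 (arXiv v1: Thm. 1.4), Def. 2.20–2.21] [cite: CossartJannsenSaito2020, Def. 6.38] [cite: Kollar2007, §1.4] -/
theorem false_of_isIsoPointTower_pCyclic_of_CP (hCP : CossartPiltant2019LocalPermissible.{u})
    (p : ℕ) (hp : p.Prime) (R : Subring L) [IsRegularLocalRing R]
    (hexc : IsExcellentRing R) (hdim : ringKrullDim R = 3) (hchar : CharP (ResidueField R) p)
    (h : R[X]) (x : L) (hmon : h.Monic) (hdeg : h.natDegree = p) (hx : aeval x h = 0)
    (hmin : ∀ g : R[X], g.natDegree < p → aeval x g = 0 → g = 0)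
    (hgen : ∀ z : L, ∃ (g : R[X]) (s : R), s ≠ 0 ∧ z * s = aeval x g)
    (hcase : (CharP L p ∧ ∀ i, 0 < i → i < p → h.coeff i = 0) ∨
      (Nat.card (L ≃ₐ[R] L) = p ∧
        ∀ σ : L ≃ₐ[R] L, ∀ y ∈ Algebra.adjoin R ({x} : Set L), σ y ∈ Algebra.adjoin R ({x} : Set L)))
    {N : ℕ} {ν : ℕ → ℕ} {T : BlowupTower.{u}} {pt : ∀ n, T.X n} (hT : IsIsoPointTower N ν T pt)
    (hint : ∀ n, IsIntegral (T.X n))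
    {k : Type u} [Field k] (g : T.X 0 ⟶ Spec (.of k)) [LocallyOfFiniteType g]
    (hνΦ : ν ≠ iterPSum N Phi) (hd0 : ringKrullDim ((T.X 0).presheaf.stalk (pt 0)) ≤ N)
    (θ₀ : (T.X 0).presheaf.stalk (pt 0) →+* L) (h₀ : Function.Injective θ₀)
    (hR0 : R ≤ θ₀.range) (hRdom : SubringDominates R θ₀.range)
    (horigin : ∀ O : ValuationSubring L, SubringDominates θ₀.range O.toSubring →
      θ₀.range = locAtCentre (Algebra.adjoin R ({x} : Set L)).toSubring O) :
    False := by
  obtain ⟨θ, hθ0, hinj, hcomp⟩ := exists_stalk_embeddings (L := L) hint hT.2.1 θ₀ h₀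
  subst hθ0
  exact false_of_isIsoPointTower_of_stalk_embeddings_of_CP_finiteType hCP p hp R hexc hdim hchar h x hmon hdeg hx hmin hgen hcase hT
    hint g hνΦ hd0 θ hinj hcomp hR0 hRdom horigin

end SliceIntrinsic

end Summit.ResolutionOfSingularities.ResolutionOfSingularities.Cruxes.SigmaMaxModifications.IdeasL1C5

end
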